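import Literature.AlgebraicGeometry.Motives.HodgeTensor
import Literature.AlgebraicGeometry.Motives.HodgeTensorDualProofs
import Literature.AlgebraicGeometry.Motives.HodgeTensorDualOpposedProofs
import Literature.AlgebraicGeometry.Motives.HodgeTensorProductProofs
import Literature.AlgebraicGeometry.Motives.HodgeTensorProofs
import Literature.AlgebraicGeometry.Motives.HodgeTensorHomSeparationProofs
import Literature.AlgebraicGeometry.Motives.HodgeTensorHomProofs
import Literature.AlgebraicGeometry.Motives.HodgeTensorPowerProofs
import Literature.AlgebraicGeometry.Motives.HodgeTensorPowerOpposedProofs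
import HarnessLib

/-!
# Deligne's tensor-filtration facts hold: `HodgeTensorFacts`

`HodgeTensorFacts` (`Motives/HodgeTensor`) bundles, as one instance hypothesis, the nine named
facts on the induced Hodge filtrations of duals, tensor products, internal Homs and tensor powers
of `ℚ`-Hodge structures (Deligne, *Théorie de Hodge II*, 1.1.6–1.1.12, 1.2.5): separation /
exhaustion of the induced filtrations and their opposedness to the complex conjugate filtration.
Each of the nine facts is proved in the tree (`HodgeTensorDualProofs`, `HodgeTensorDualOpposedProofs`,
`HodgeTensorProductProofs`, `HodgeTensorProofs`, `HodgeTensorHomSeparationProofs`,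
`HodgeTensorHomProofs`, `HodgeTensorPowerProofs`, `HodgeTensorPowerOpposedProofs`); this file
assembles them into the theorem `hodgeTensorFacts_holds : HodgeTensorFacts.{u, v}`, so that statements
carrying `[HodgeTensorFacts]` (Mumford–Tate groups, Hodge loci, the routes
`HodgeConjecture/PeriodDeficiency`, `…/PeriodsPolice`) are unconditional in this respect: supply the
instance locally with `haveI := hodgeTensorFacts_holds.{u, v}` (no global instance is registered here,
to keep this a pure proof file; a one-line `attribute [instance] hodgeTensorFacts_holds` does it).

## References

* P. Deligne, *Théorie de Hodge II*, Publ. Math. IHÉS 40 (1971), 1.1.6–1.1.12, 1.2.5.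
-/

universe u v

namespace Literature.AlgebraicGeometry.Motives

/-- **Deligne's tensor-filtration facts hold** (Hodge II, 1.1.6–1.1.12 and 1.2.5): the induced
filtrations on `V^∨`, `V ⊗ W`, `Hom(V, W)` and `V^{⊗r}` of `ℚ`-Hodge structures are separated /
exhaustive and opposed to their complex conjugates, i.e. every field of `HodgeTensorFacts` —
assembled from the nine proved facts `HodgeStructure.*_holds` of the tree.
[cite: DeligneHodgeII1971, 1.1.6–1.1.12 and 1.2.5] -/
theorem hodgeTensorFacts_holds : HodgeTensorFacts.{u, v} where
  exists_dualFiltration_eq_bot := HodgeStructure.exists_dualFiltration_eq_bot_holds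
  isCompl_dualFiltration := HodgeStructure.isCompl_dualFiltration_holds
  exists_tensorFiltration_eq_bot := HodgeStructure.exists_tensorFiltration_eq_bot_holds
  isCompl_tensorFiltration := HodgeStructure.isCompl_tensorFiltration_holds
  exists_homFiltration_eq_bot := HodgeStructure.exists_homFiltration_eq_bot_holds
  isCompl_homFiltration := HodgeStructure.isCompl_homFiltration_holds
  exists_tensorPowerFiltration_eq_top := HodgeStructure.exists_tensorPowerFiltration_eq_top_holds
  exists_tensorPowerFiltration_eq_bot := HodgeStructure.exists_tensorPowerFiltration_eq_bot_holds
  isCompl_tensorPowerFiltration := HodgeStructure.isCompl_tensorPowerFiltration_holds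

end Literature.AlgebraicGeometry.Motives
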